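import Summits.Parity.GeneralizedHardyLittlewood.Theses.LiouvilleShiftedTables
import Summits.Parity.GeneralizedHardyLittlewood.Theorems.TableChowla.Negative.TableChowlaExceptionalSet
import Summits.Parity.GeneralizedHardyLittlewood.Theorems.TableChowla.Negative.TableChowlaOperatorNorm

/-!
# Crux-ideate round 2, ideator 5 — calibration anchors for the report (crux stmt-Parity-14270,
# `LiouvilleShiftedTables.TableChowla`)

Two kernel-checked NECESSARY CONDITIONS of the crux, displayed in the shape the round-2 report
(`IDEATOR5-REPORT.md`) argues from.  Both are corollaries of landed `Negative/*` theorems; nothing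
here concludes the crux (this is not a line).

* `fixedResidueLevel_of_tableChowla` — for EVERY level `θ ∈ [7/12, 1)` the crux implies the
  fixed-residue, absolute-value level-of-distribution statement `FixedResidueLevel θ` for `λ`
  (moduli `b ≤ x^θ`, one residue `c`, progression segments of `x^{1−θ}` terms, every log-power
  saving).  Read at `θ → 1`: the crux contains the `λ`-analogue of "level of distribution
  `x^{1/2+δ}` in the weak (fixed-residue) sense" for EVERY `δ < 1/2` — the problem Fouvry–Radziwiłł
  (arXiv:1811.08672, Introduction) call "a major open problem … beyond the capability of GRH" already
  for one `δ > 0`.  (The landed `fixedResidueFace_of_tableChowla`, p71931, is the `∀δ` form; this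
  corollary only instantiates `A = x^{1−θ}` — the chain kept quoting the single value `11/12`.)
* `muDilationFace_of_tableChowla` — the crux implies the DILATION-AVERAGED, FIXED-SHIFT binary
  `μ`–`λ` correlation bound `Σ_{a∼A} |Σ_{b ≤ x/A} μ(b) λ(ab+c)| ≤ 2x/(log x)^C` (moduli `a ≤ x^{5/12}`,
  all inside the Bombieri–Vinogradov range): the face of the crux that survives ANY re-cut to
  structured (Heath-Brown) coefficients, and is of the same species as the route's terminal atom
  `MAvg` (`Σ_{m ≤ x^ε} log m |Σ_d μ(d)Λ(dm+h)| = o(x)`).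
-/

namespace Summit.Parity.GeneralizedHardyLittlewood.Cruxes.TableChowla.Ideator5

open Finset Real
open Summit.Parity.GeneralizedHardyLittlewood.Theses
open Summit.Parity.GeneralizedHardyLittlewood.Theorems.TableChowla.Negative

noncomputable section

/-- Fixed-residue `ℓ¹` level of distribution `θ` for `λ`, short-segment form: for every shift
`c ≠ 0` and every `C`, eventually `Σ_{b ≤ x/x^{1−θ}} |Σ_{a ∈ (x^{1−θ}, 2x^{1−θ}]} λ(ab+c)| ≤ x/(log x)^C`
(moduli `b` up to `≍ x^θ`, one residue class `c mod b`, segments of `≍ x^{1−θ}` terms). -/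
def FixedResidueLevel (θ : ℝ) : Prop :=
  ∀ c : ℤ, c ≠ 0 → ∀ C : ℝ, 0 < C → ∃ x₀ : ℝ, ∀ x : ℝ, x₀ ≤ x →
    (∑ b ∈ Icc 1 ⌊x / x ^ (1 - θ)⌋₊,
        |colSum lam c ⌊x ^ (1 - θ)⌋₊ ⌊2 * x ^ (1 - θ)⌋₊ b|) ≤ x / Real.log x ^ C

/-- **`TableChowla → FixedResidueLevel θ` for every `θ ∈ [7/12, 1)`** (instantiate the `∀δ` face
`fixedResidueFace_of_tableChowla` at `δ = min (1/12) (1−θ)`, `A = x^{1−θ}`). -/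
theorem fixedResidueLevel_of_tableChowla (h : LiouvilleShiftedTables.TableChowla) {θ : ℝ}
    (hθ : 7 / 12 ≤ θ) (hθ' : θ < 1) : FixedResidueLevel θ := by
  intro c hc C hC
  set δ : ℝ := min (1 / 12) (1 - θ) with hδdef
  have hδpos : 0 < δ := lt_min (by norm_num) (by linarith)
  have hδle : δ ≤ 1 / 12 := min_le_left _ _
  have hδle' : δ ≤ 1 - θ := min_le_right _ _
  obtain ⟨x₀, hx₀⟩ := fixedResidueFace_of_tableChowla h c hc δ hδpos hδle C hC
  refine ⟨max x₀ 1, fun x hx => ?_⟩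
  have hx₀x : x₀ ≤ x := le_trans (le_max_left _ _) hx
  have hx1 : 1 ≤ x := le_trans (le_max_right _ _) hx
  have hA : x ^ δ ≤ x ^ (1 - θ) := Real.rpow_le_rpow_of_exponent_le hx1 hδle'
  have hA' : x ^ (1 - θ) ≤ x ^ (1 / 3 + δ) := by
    apply Real.rpow_le_rpow_of_exponent_le hx1
    rcases le_total (1 / 12 : ℝ) (1 - θ) with h12 | h12
    · have : δ = 1 / 12 := by rw [hδdef]; exact min_eq_left h12
      rw [this]; linarith
    · have : δ = 1 - θ := by rw [hδdef]; exact min_eq_right h12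
      rw [this]; linarith
  exact hx₀ x hx₀x (x ^ (1 - θ)) hA hA'

/-- The DILATION-AVERAGED FIXED-SHIFT `μ`–`λ` FACE: `Σ_{a ∼ A} |Σ_{b ≤ x/A} μ(b) λ(ab+c)| ≤ 2x/(log x)^C`
in the crux's window. -/
def MuDilationFace : Prop :=
  ∀ c : ℤ, c ≠ 0 → ∀ δ : ℝ, 0 < δ → δ ≤ 1 / 12 → ∀ C : ℝ, 0 < C → ∃ x₀ : ℝ, ∀ x : ℝ, x₀ ≤ x →
    ∀ A : ℝ, x ^ δ ≤ A → A ≤ x ^ (1 / 3 + δ) →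
      (∑ a ∈ Ioc ⌊A⌋₊ ⌊2 * A⌋₊,
        |∑ b ∈ Icc 1 ⌊x / A⌋₊, (ArithmeticFunction.moebius b : ℝ) * entry c a b|) ≤
        2 * x / Real.log x ^ C

/-- Auxiliary: `Σ μ(b)² ≤ #` on any finset. -/
theorem sum_moebius_sq_le (s : Finset ℕ) :
    ∑ b ∈ s, ((ArithmeticFunction.moebius b : ℝ)) ^ 2 ≤ s.card := by
  have : ∀ b ∈ s, ((ArithmeticFunction.moebius b : ℝ)) ^ 2 ≤ 1 := by
    intro b _
    have hb : |(ArithmeticFunction.moebius b : ℝ)| ≤ 1 := by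
      have := ArithmeticFunction.abs_moebius_le_one (n := b)
      exact_mod_cast this
    have := (sq_le_one_iff_abs_le_one ((ArithmeticFunction.moebius b : ℝ))).mpr hb
    simpa using this
  calc ∑ b ∈ s, ((ArithmeticFunction.moebius b : ℝ)) ^ 2 ≤ ∑ b ∈ s, (1 : ℝ) := sum_le_sum this
    _ = s.card := by simp

/-- **`TableChowla → MuDilationFace`**: test vectors `u = sign(row)/√rows`, `v = μ/√B` in the
operator-norm form (`operatorNormForm_of_tableChowla`, p73186), then `rows·B ≤ 2x`. -/
theorem muDilationFace_of_tableChowla (h : LiouvilleShiftedTables.TableChowla) : MuDilationFace := by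
  intro c hc δ hδ hδ' C hC
  obtain ⟨x₀, hx₀⟩ := operatorNormForm_of_tableChowla h c hc δ hδ hδ' C hC
  refine ⟨max x₀ 1, fun x hx A hA hA' => ?_⟩
  have hx₀x : x₀ ≤ x := le_trans (le_max_left _ _) hx
  have hx1 : 1 ≤ x := le_trans (le_max_right _ _) hx
  have hxpos : 0 < x := by linarith
  obtain ⟨hRB, hB1⟩ := rows_mul_cols_le_window hx1 hδ.le (by linarith) hA hA'
  set I : Finset ℕ := Ioc ⌊A⌋₊ ⌊2 * A⌋₊ with hI
  set J : Finset ℕ := Icc 1 ⌊x / A⌋₊ with hJ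
  -- row sums against μ and their signs
  set r : ℕ → ℝ := fun a => ∑ b ∈ J, (ArithmeticFunction.moebius b : ℝ) * entry c a b with hr
  set s : ℕ → ℝ := fun a => if 0 ≤ r a then 1 else -1 with hs
  have hs_mul : ∀ a, s a * r a = |r a| := by
    intro a
    by_cases h0 : 0 ≤ r a
    · simp [hs, h0, abs_of_nonneg h0]
    · have h0' : r a < 0 := lt_of_not_ge h0
      simp [hs, h0, abs_of_neg h0']
  have hs_sq : ∀ a, s a ^ 2 = 1 := by
    intro a; by_cases h0 : 0 ≤ r a <;> simp [hs, h0]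
  -- sizes
  set N : ℝ := (I.card : ℝ) with hN
  set B : ℝ := (J.card : ℝ) with hB
  have hIcard : I.card = ⌊2 * A⌋₊ - ⌊A⌋₊ := by rw [hI, Nat.card_Ioc]
  have hJcard : J.card = ⌊x / A⌋₊ := by rw [hJ, Nat.card_Icc]; omega
  have hNB : N * B ≤ 2 * x := by rw [hN, hB, hIcard, hJcard]; exact hRB
  have hBpos : 0 < B := by rw [hB, hJcard]; exact_mod_cast hB1
  -- the target sum
  have hgoal_eq : (∑ a ∈ I, |r a|) = ∑ a ∈ I, s a * r a := by
    refine sum_congr rfl fun a _ => (hs_mul a).symm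
  rcases Nat.eq_zero_or_pos I.card with hI0 | hIpos
  · -- no rows: the sum is empty
    have hIe : I = ∅ := Finset.card_eq_zero.mp hI0
    have : (∑ a ∈ I, |r a|) = 0 := by rw [hIe]; simp
    rw [this]
    exact div_nonneg (by linarith) (Real.rpow_nonneg (Real.log_nonneg hx1) C)
  have hNpos : 0 < N := by rw [hN]; exact_mod_cast hIpos
  -- test vectors
  set u : ℕ → ℝ := fun a => s a / Real.sqrt N with hu
  set v : ℕ → ℝ := fun b => (ArithmeticFunction.moebius b : ℝ) / Real.sqrt B with hv
  have hsqN : 0 < Real.sqrt N := Real.sqrt_pos.mpr hNpos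
  have hsqB : 0 < Real.sqrt B := Real.sqrt_pos.mpr hBpos
  have hu1 : ∑ a ∈ I, u a ^ 2 ≤ 1 := by
    have : ∑ a ∈ I, u a ^ 2 = ∑ a ∈ I, (1 / N) := by
      refine sum_congr rfl fun a _ => ?_
      rw [hu]; dsimp only; rw [div_pow, hs_sq a, Real.sq_sqrt hNpos.le]
    rw [this, sum_const, nsmul_eq_mul, ← hN, mul_one_div, div_self hNpos.ne']
  have hv1 : ∑ b ∈ J, v b ^ 2 ≤ 1 := by
    have : ∑ b ∈ J, v b ^ 2 = (∑ b ∈ J, (ArithmeticFunction.moebius b : ℝ) ^ 2) / B := by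
      rw [sum_div]
      refine sum_congr rfl fun b _ => ?_
      rw [hv]; dsimp only; rw [div_pow, Real.sq_sqrt hBpos.le]
    rw [this, div_le_one hBpos, hB]
    exact sum_moebius_sq_le J
  have key := hx₀ x hx₀x A hA hA' u v hu1 hv1
  -- identify the bilinear form with (Σ |r a|)/√(N B)
  have hform : (∑ a ∈ I, ∑ b ∈ J, u a * v b * entry c a b) =
      (∑ a ∈ I, s a * r a) / (Real.sqrt N * Real.sqrt B) := by
    rw [sum_div]
    refine sum_congr rfl fun a _ => ?_
    rw [hr]; dsimp only
    rw [mul_sum, sum_div]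
    refine sum_congr rfl fun b _ => ?_
    rw [hu, hv]; dsimp only
    field_simp
  rw [hform, abs_div, abs_of_pos (mul_pos hsqN hsqB), div_le_iff₀ (mul_pos hsqN hsqB),
    ← hgoal_eq] at key
  rw [abs_of_nonneg (sum_nonneg fun a _ => abs_nonneg (r a))] at key
  -- √N √B ≤ √(2x) ≤ 2 √x, and √x · √x = x
  have hsqNB : Real.sqrt N * Real.sqrt B ≤ 2 * Real.sqrt x := by
    rw [← Real.sqrt_mul hNpos.le]
    calc Real.sqrt (N * B) ≤ Real.sqrt (2 * x) := Real.sqrt_le_sqrt hNB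
      _ = Real.sqrt 2 * Real.sqrt x := Real.sqrt_mul (by norm_num) x
      _ ≤ 2 * Real.sqrt x := by
          apply mul_le_mul_of_nonneg_right _ (Real.sqrt_nonneg x)
          rw [show (2:ℝ) = Real.sqrt 4 by rw [show (4:ℝ) = 2^2 by norm_num, Real.sqrt_sq (by norm_num)]]
          exact Real.sqrt_le_sqrt (by norm_num)
  have hlog0 : 0 ≤ Real.log x ^ C := Real.rpow_nonneg (Real.log_nonneg hx1) C
  have hR0 : 0 ≤ x ^ (1 / 2 : ℝ) / Real.log x ^ C := by positivity
  have hxhalf : x ^ (1 / 2 : ℝ) = Real.sqrt x := (Real.sqrt_eq_rpow x).symm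
  calc (∑ a ∈ I, |r a|) ≤ x ^ (1 / 2 : ℝ) / Real.log x ^ C * (Real.sqrt N * Real.sqrt B) := key
    _ ≤ x ^ (1 / 2 : ℝ) / Real.log x ^ C * (2 * Real.sqrt x) :=
        mul_le_mul_of_nonneg_left hsqNB hR0
    _ = 2 * x / Real.log x ^ C := by
        have hxx : Real.sqrt x * Real.sqrt x = x := Real.mul_self_sqrt hxpos.le
        rw [hxhalf, div_mul_eq_mul_div]
        congr 1
        rw [mul_left_comm, hxx]

end

end Summit.Parity.GeneralizedHardyLittlewood.Cruxes.TableChowla.Ideator5
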